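import Literature.Algebra.EuclideanLattices.LLLAlgorithmTermination
import HarnessLib

/-!
# Sizes along the LLL algorithm: discharge of `lll_norm_sq_le`

Trunk: Lattice; sibling proof file of `LLLAlgorithm.lean`, continuing
`LLLAlgorithmTermination.lean`. We prove the second half of the proof of Prop. 1.26 of
A. K. Lenstra, H. W. Lenstra Jr., L. Lovász, *Factoring polynomials with rational coefficients*,
Math. Ann. 261 (1982) (LLL82) — the bound `|bᵢ|² ≤ n² (4B)ⁿ` on all vectors met by the
algorithm — in the form of M. R. Bremner, *Lattice Basis Reduction* (CRC 2011), Thm. 4.23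
(equations (4.6)–(4.9)), with the bookkeeping made explicit as a three-clause invariant of
`lllStep` (`lllStep_size_invariant`):

1. `‖b*ⱼ‖² ≤ B` for all `j` (size reductions fix the `b*ⱼ`; an exchange replaces
   `b*ₖ₋₁, b*ₖ` by vectors of squared norm `< δ‖b*ₖ₋₁‖²` and `≤ ‖b*ₖ₋₁‖²`,
   `sq_norm_gramSchmidt_swap_right_le`);
2. `‖bᵢ‖² ≤ nB` for the rows `i > k` (such a row is an input row or a formerly size-reduced
   row, and size-reduced rows satisfy `‖bᵢ‖² ≤ (1 + i/4)B`, `sq_norm_le_of_sizeReduced_row`);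
3. `|μₖⱼ| ≤ 2^{n-1-k} C` for `j < k`, where `C² = n B^{n-1}`: after an increment the new row
   `k` is a short row and `μₖⱼ² ≤ dⱼ ‖bₖ‖² ≤ Bʲ · nB ≤ C²` (integrality `d_{j+1} ≥ 1` of the
   Gram determinants of integer vectors, `gsCoeff_sq_le_gramDet_mul`); at an exchange the row
   moves down with `k` and its coefficients at most double
   (`|μₖⱼ - r μₖ₋₁,ⱼ| ≤ |μₖⱼ| + (|μₖ,ₖ₋₁| + ½)/2`, Bremner's "μₖ increases by at most a
   factor of 2").

Hence `‖bₖ‖² ≤ n (2^{n-1-k} C)² B ≤ n² 4^{n-1-k} Bⁿ` and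
`Literature.Lattice.lll_norm_sq_le_holds : lll_norm_sq_le`.

## References

* A. K. Lenstra, H. W. Lenstra Jr., L. Lovász, Math. Ann. 261 (1982), proof of Prop. 1.26.
* M. R. Bremner, *Lattice Basis Reduction*, CRC Press 2011, Thm. 4.23.
-/

noncomputable section

namespace Literature.Algebra.EuclideanLattices

open InnerProductSpace Function Submodule Finset
open scoped RealInnerProductSpace

/-! ### More on the exchange step: the other Gram–Schmidt vectors -/

section Exchange2

variable {E : Type*} [NormedAddCommGroup E] [InnerProductSpace ℝ E] {n : ℕ}

/-- A permutation of the family fixing every index `≥ i` does not change `b*ᵢ`. [folklore] -/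
theorem gramSchmidt_comp_perm_of_fix (f : Fin n → E) (σ : Equiv.Perm (Fin n)) (i : Fin n)
    (hσ : ∀ l, i ≤ l → σ l = l) : gramSchmidt ℝ (f ∘ σ) i = gramSchmidt ℝ f i := by
  have hlt : ∀ l, l < i → σ l < i := by
    intro l hl
    by_contra h
    have h' : i ≤ σ l := not_lt.1 h
    have h2 : σ (σ l) = σ l := hσ (σ l) h'
    have h3 : σ l = l := σ.injective h2
    rw [h3] at h'
    exact absurd hl (not_lt.2 h')
  have himg : (f ∘ σ) '' Set.Iio i = f '' Set.Iio i := by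
    ext x
    simp only [Set.mem_image, Set.mem_Iio, comp_apply]
    constructor
    · rintro ⟨l, hl, rfl⟩
      exact ⟨σ l, hlt l hl, rfl⟩
    · rintro ⟨l, hl, rfl⟩
      refine ⟨σ.symm l, ?_, by simp⟩
      by_contra h
      have h' : i ≤ σ.symm l := not_lt.1 h
      have h2 := hσ _ h'
      rw [Equiv.apply_symm_apply] at h2
      rw [← h2] at h'
      exact absurd hl (not_lt.2 h')
  symm
  apply eq_gramSchmidt_of_sub_mem_span
  · rw [himg, comp_apply, hσ i le_rfl]
    exact gramSchmidt_sub_self_mem_span f i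
  · intro u hu
    rw [himg] at hu
    exact inner_gramSchmidt_eq_zero_of_mem_span f hu

/-- After an exchange, the Gram–Schmidt vectors beyond both exchanged positions are unchanged.
[cite: LenstraLenstraLovasz1982, §1 (proof of Prop. 1.26)] [cite: Bremner2011, Lemma 4.12] -/
theorem gramSchmidt_swap_of_lt (f : Fin n → E) (j k i : Fin n) (hji : j < i) (hki : k < i) :
    gramSchmidt ℝ (f ∘ Equiv.swap j k) i = gramSchmidt ℝ f i :=
  gramSchmidt_comp_perm_of_fix f _ i fun _ hl =>
    Equiv.swap_apply_of_ne_of_ne (ne_of_gt (lt_of_lt_of_le hji hl))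
      (ne_of_gt (lt_of_lt_of_le hki hl))

/-- After an exchange, the Gram–Schmidt vectors before both exchanged positions are unchanged.
[folklore] -/
theorem gramSchmidt_swap_of_gt (f : Fin n → E) (j k i : Fin n) (hij : i < j) (hik : i < k) :
    gramSchmidt ℝ (f ∘ Equiv.swap j k) i = gramSchmidt ℝ f i :=
  gramSchmidt_congr_of_forall_le fun l hl => by
    rw [comp_apply, Equiv.swap_apply_of_ne_of_ne (ne_of_lt (lt_of_le_of_lt hl hij))
      (ne_of_lt (lt_of_le_of_lt hl hik))]

/-- **Exchange lemma, second vector** (LLL82: `|c*ₖ|² ≤ |b*ₖ₋₁|²`; Bremner Lemma 4.12): after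
exchanging `bⱼ, bⱼ₊₁` in a linearly independent family, `‖(new b)*ⱼ₊₁‖ ≤ ‖b*ⱼ‖` (from
`dⱼ₊₂`, `dⱼ` being unchanged and `‖(new b)*ⱼ‖² = ‖b*ⱼ₊₁‖² + μ² ‖b*ⱼ‖² ≥ ‖b*ⱼ₊₁‖²`).
[cite: LenstraLenstraLovasz1982, §1 (proof of Prop. 1.26)] [cite: Bremner2011, Lemma 4.12] -/
theorem sq_norm_gramSchmidt_swap_right_le {f : Fin n → E} (hf : LinearIndependent ℝ f)
    (j k : Fin n) (hjk : (k : ℕ) = j + 1) :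
    ‖gramSchmidt ℝ (f ∘ Equiv.swap j k) k‖ ^ 2 ≤ ‖gramSchmidt ℝ f j‖ ^ 2 := by
  set g := f ∘ Equiv.swap j k with hg
  have hjk' : j < k := Fin.lt_def.2 (by omega)
  -- `d_{k+1}` and `d_j` are unchanged
  have h1 : gramDet g (k + 1) k.isLt = gramDet f (k + 1) k.isLt := by
    rcases eq_or_lt_of_le (Nat.succ_le_of_lt k.isLt) with h | h
    · rw [gramDet_eq_of_eq g h k.isLt le_rfl, gramDet_eq_of_eq f h k.isLt le_rfl, hg,
        gramDet_self_swap]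
    · exact gramDet_swap_of_lt f j k hjk' _ _ (by simp)
  have h2 : gramDet g j (le_of_lt j.isLt) = gramDet f j (le_of_lt j.isLt) :=
    gramDet_swap_of_le f j k hjk' _ _ le_rfl
  have hkj : ∀ φ : Fin n → E, gramDet φ (k + 1) k.isLt =
      gramDet φ j (le_of_lt j.isLt) * ‖gramSchmidt ℝ φ j‖ ^ 2 * ‖gramSchmidt ℝ φ k‖ ^ 2 := by
    intro φ
    rw [gramDet_succ φ k]
    congr 1
    have : gramDet φ k (le_of_lt k.isLt) = gramDet φ (j + 1) j.isLt := by congr 1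
    rw [this, gramDet_succ φ j]
  rw [hkj, hkj, h2] at h1
  have hdj : 0 < gramDet f j (le_of_lt j.isLt) := gramDet_pos hf _ _
  have hprod : ‖gramSchmidt ℝ g j‖ ^ 2 * ‖gramSchmidt ℝ g k‖ ^ 2 =
      ‖gramSchmidt ℝ f j‖ ^ 2 * ‖gramSchmidt ℝ f k‖ ^ 2 := by
    rw [mul_assoc, mul_assoc] at h1
    exact mul_left_cancel₀ hdj.ne' h1
  have hgj : ‖gramSchmidt ℝ g j‖ ^ 2 =
      ‖gramSchmidt ℝ f k‖ ^ 2 + gsCoeff f k j ^ 2 * ‖gramSchmidt ℝ f j‖ ^ 2 := by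
    rw [hg, gramSchmidt_swap_adjacent f j k hjk, ← real_inner_self_eq_norm_sq, inner_add_left,
      inner_add_right, inner_add_right, real_inner_smul_left, real_inner_smul_right,
      real_inner_smul_left, real_inner_smul_right, real_inner_self_eq_norm_sq,
      real_inner_self_eq_norm_sq, gramSchmidt_orthogonal ℝ f hjk'.ne',
      gramSchmidt_orthogonal ℝ f hjk'.ne]
    ring
  have hfk : 0 < ‖gramSchmidt ℝ f k‖ ^ 2 :=
    pow_pos (norm_pos_iff.2 (gramSchmidt_ne_zero _ hf)) 2
  have hge : ‖gramSchmidt ℝ f k‖ ^ 2 ≤ ‖gramSchmidt ℝ g j‖ ^ 2 := by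
    rw [hgj]; exact le_add_of_nonneg_right (mul_nonneg (sq_nonneg _) (sq_nonneg _))
  have hgj_pos : 0 < ‖gramSchmidt ℝ g j‖ ^ 2 := lt_of_lt_of_le hfk hge
  by_contra hlt
  have hlt' : ‖gramSchmidt ℝ f j‖ ^ 2 < ‖gramSchmidt ℝ g k‖ ^ 2 := not_le.1 hlt
  have := mul_lt_mul' hge hlt' (sq_nonneg _) hgj_pos
  rw [hprod, mul_comm] at this
  exact lt_irrefl _ this

end Exchange2

/-! ### Elementary bounds -/

section Bounds

variable {E : Type*} [NormedAddCommGroup E] [InnerProductSpace ℝ E] {n : ℕ}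

/-- `dᵢ ≤ Bⁱ` from a bound on the Gram–Schmidt norms. [cite: LenstraLenstraLovasz1982, proof of Prop. 1.26] -/
theorem gramDet_le_pow_of_gramSchmidt (f : Fin n → E) {B : ℝ}
    (hB : ∀ j, ‖gramSchmidt ℝ f j‖ ^ 2 ≤ B) (i : ℕ) (hi : i ≤ n) : gramDet f i hi ≤ B ^ i := by
  rw [gramDet_eq_prod]
  calc ∏ j : Fin i, ‖gramSchmidt ℝ f (Fin.castLE hi j)‖ ^ 2 ≤ ∏ _j : Fin i, B :=
        Finset.prod_le_prod (fun j _ => sq_nonneg _) fun j _ => hB _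
    _ = B ^ i := by simp

/-- Cauchy–Schwarz for the Gram–Schmidt coefficients: `μᵢⱼ² ‖b*ⱼ‖² ≤ ‖bᵢ‖²`. [folklore] -/
theorem gsCoeff_sq_mul_le (f : Fin n → E) (i j : Fin n) :
    gsCoeff f i j ^ 2 * ‖gramSchmidt ℝ f j‖ ^ 2 ≤ ‖f i‖ ^ 2 := by
  by_cases h0 : gramSchmidt ℝ f j = 0
  · rw [h0, norm_zero]; simp
  · have hpos : 0 < ‖gramSchmidt ℝ f j‖ ^ 2 := pow_pos (norm_pos_iff.2 h0) 2
    have hcs := abs_real_inner_le_norm (f i) (gramSchmidt ℝ f j)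
    have hcs2 : ⟪f i, gramSchmidt ℝ f j⟫ ^ 2 ≤ ‖f i‖ ^ 2 * ‖gramSchmidt ℝ f j‖ ^ 2 := by
      rw [← sq_abs, ← mul_pow]
      exact pow_le_pow_left₀ (abs_nonneg _) hcs 2
    rw [gsCoeff, div_pow]
    rw [show (‖gramSchmidt ℝ f j‖ ^ 2) ^ 2 = ‖gramSchmidt ℝ f j‖ ^ 2 * ‖gramSchmidt ℝ f j‖ ^ 2
      by ring, div_mul_eq_mul_div, mul_div_mul_right _ _ hpos.ne', div_le_iff₀ hpos]
    exact hcs2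

/-- With integral Gram determinants (`d_{j+1} ≥ 1`): `μᵢⱼ² ≤ dⱼ ‖bᵢ‖²` (LLL82's bound
`|μₖⱼ|² ≤ d_{j-1} |bₖ|²/… `; Bremner Prop. 3.11(c)). [cite: LenstraLenstraLovasz1982, proof of Prop. 1.26] [cite: Bremner2011, Thm. 4.23 (proof)] -/
theorem gsCoeff_sq_le_gramDet_mul (f : Fin n → E) (i j : Fin n)
    (h1 : 1 ≤ gramDet f (j + 1) j.isLt) :
    gsCoeff f i j ^ 2 ≤ gramDet f j (le_of_lt j.isLt) * ‖f i‖ ^ 2 := by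
  rw [gramDet_succ] at h1
  have hd : 0 ≤ gramDet f j (le_of_lt j.isLt) := gramDet_nonneg f _ _
  calc gsCoeff f i j ^ 2 = gsCoeff f i j ^ 2 * 1 := (mul_one _).symm
    _ ≤ gsCoeff f i j ^ 2 * (gramDet f j (le_of_lt j.isLt) * ‖gramSchmidt ℝ f j‖ ^ 2) :=
        mul_le_mul_of_nonneg_left h1 (sq_nonneg _)
    _ = gramDet f j (le_of_lt j.isLt) * (gsCoeff f i j ^ 2 * ‖gramSchmidt ℝ f j‖ ^ 2) := by ring
    _ ≤ gramDet f j (le_of_lt j.isLt) * ‖f i‖ ^ 2 :=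
        mul_le_mul_of_nonneg_left (gsCoeff_sq_mul_le f i j) hd

/-- A size-reduced row is short: if `|μᵢⱼ| ≤ 1/2` for all `j < i` and all `‖b*ⱼ‖² ≤ B` then
`‖bᵢ‖² ≤ n B` (LLL82 (1.30): `|bᵢ|² ≤ nB` for `i ≠ k`; Bremner (4.7) with `μₖ = 1`).
[cite: LenstraLenstraLovasz1982, proof of Prop. 1.26] [cite: Bremner2011, Thm. 4.23 (4.7)] -/
theorem sq_norm_le_of_sizeReduced_row (f : Fin n → E) {B : ℝ}
    (hB : ∀ j, ‖gramSchmidt ℝ f j‖ ^ 2 ≤ B) (i : Fin n)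
    (hμ : ∀ j, j < i → |gsCoeff f i j| ≤ 1 / 2) : ‖f i‖ ^ 2 ≤ n * B := by
  have hB0 : 0 ≤ B := (sq_nonneg _).trans (hB i)
  rw [sq_norm_eq_sq_norm_gramSchmidt_add_sum f i]
  have hsum : ∑ j ∈ Finset.Iio i, gsCoeff f i j ^ 2 * ‖gramSchmidt ℝ f j‖ ^ 2 ≤
      ∑ _j ∈ Finset.Iio i, B := by
    refine Finset.sum_le_sum fun j hj => ?_
    have h1 : gsCoeff f i j ^ 2 ≤ 1 := by
      have h := hμ j (Finset.mem_Iio.1 hj)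
      have hsq : gsCoeff f i j ^ 2 ≤ (1 / 2) ^ 2 := by
        rw [← sq_abs]
        exact pow_le_pow_left₀ (abs_nonneg _) h 2
      linarith
    calc gsCoeff f i j ^ 2 * ‖gramSchmidt ℝ f j‖ ^ 2 ≤ 1 * ‖gramSchmidt ℝ f j‖ ^ 2 :=
          mul_le_mul_of_nonneg_right h1 (sq_nonneg _)
      _ ≤ B := by rw [one_mul]; exact hB j
  rw [Finset.sum_const, Fin.card_Iio, nsmul_eq_mul] at hsum
  have hi : (i : ℝ) + 1 ≤ n := by exact_mod_cast Nat.succ_le_of_lt i.isLt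
  nlinarith [hB i]

/-- The general bound on a row: if `|μᵢⱼ| ≤ R` for all `j < i`, `1 ≤ R`, and all
`‖b*ⱼ‖² ≤ B`, then `‖bᵢ‖² ≤ n R² B` (Bremner (4.7)). [cite: Bremner2011, Thm. 4.23 (4.7)] -/
theorem sq_norm_le_of_abs_gsCoeff_le (f : Fin n → E) {B R : ℝ}
    (hB : ∀ j, ‖gramSchmidt ℝ f j‖ ^ 2 ≤ B) (hR : 1 ≤ R) (i : Fin n)
    (hμ : ∀ j, j < i → |gsCoeff f i j| ≤ R) : ‖f i‖ ^ 2 ≤ n * R ^ 2 * B := by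
  have hB0 : 0 ≤ B := (sq_nonneg _).trans (hB i)
  rw [sq_norm_eq_sq_norm_gramSchmidt_add_sum f i]
  have hsum : ∑ j ∈ Finset.Iio i, gsCoeff f i j ^ 2 * ‖gramSchmidt ℝ f j‖ ^ 2 ≤
      ∑ _j ∈ Finset.Iio i, R ^ 2 * B := by
    refine Finset.sum_le_sum fun j hj => ?_
    have h1 : gsCoeff f i j ^ 2 ≤ R ^ 2 := by
      rw [← sq_abs]
      exact pow_le_pow_left₀ (abs_nonneg _) (hμ j (Finset.mem_Iio.1 hj)) 2
    exact mul_le_mul h1 (hB j) (sq_nonneg _) (by positivity)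
  rw [Finset.sum_const, Fin.card_Iio, nsmul_eq_mul] at hsum
  have hi : (i : ℝ) + 1 ≤ n := by exact_mod_cast Nat.succ_le_of_lt i.isLt
  have hR2 : 1 ≤ R ^ 2 := by nlinarith
  nlinarith [hB i, mul_nonneg (sub_nonneg.2 hR2) hB0]

end Bounds

/-! ### The row operation, quantitatively -/

section Measured2

variable {E : Type*} [NormedAddCommGroup E] [InnerProductSpace ℝ E]
variable {V : Type*} [AddCommGroup V] (φ : V →+ E) {n : ℕ}

/-- `reduce(k, l)` changes only row `k`. [cite: LenstraLenstraLovasz1982, §1 Fig. 1 (∗)] -/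
theorem lllSizeReduce_apply_of_ne (b : Fin n → V) (k l : Fin n) {i : Fin n} (hi : i ≠ k) :
    lllSizeReduce φ b k l i = b i := by
  unfold lllSizeReduce
  split_ifs
  · rfl
  · exact update_of_ne hi _ _

/-- The size-reduction loop changes only row `k`. [cite: LenstraLenstraLovasz1982, §1 Fig. 1] -/
theorem lllSizeReduceFrom_apply_of_ne (k : Fin n) {i : Fin n} (hi : i ≠ k) :
    ∀ (a : ℕ) (ha : a ≤ n) (b : Fin n → V), lllSizeReduceFrom φ k a ha b i = b i
  | 0, _, _ => rfl
  | a + 1, ha, b => by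
    rw [lllSizeReduceFrom, lllSizeReduceFrom_apply_of_ne k hi a, lllSizeReduce_apply_of_ne φ b _ _ hi]

/-- `reduce(k, l)` is `bₖ ← bₖ - c • bₗ` on the measured family with `|c| ≤ |μₖₗ| + 1/2`
(`c = 0` or `c = round μₖₗ`). [cite: LenstraLenstraLovasz1982, §1 Fig. 1 (∗)] [cite: Bremner2011, Thm. 4.23 (proof)] -/
theorem exists_comp_lllSizeReduce_eq_abs_le (b : Fin n → V) (k l : Fin n) :
    ∃ c : ℝ, |c| ≤ |gsCoeff (⇑φ ∘ b) k l| + 1 / 2 ∧ (⇑φ ∘ lllSizeReduce φ b k l) =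
      update (⇑φ ∘ b) k ((⇑φ ∘ b) k - c • (⇑φ ∘ b) l) := by
  unfold lllSizeReduce
  split_ifs
  · exact ⟨0, by simp; positivity, by simp⟩
  · refine ⟨_, ?_, comp_update_sub_zsmul φ b k l _⟩
    have h := abs_sub_round (gsCoeff (⇑φ ∘ b) k l)
    have := abs_sub_abs_le_abs_sub (round (gsCoeff (⇑φ ∘ b) k l) : ℝ) (gsCoeff (⇑φ ∘ b) k l)
    rw [abs_sub_comm] at this
    linarith

end Measured2

section SizeInvariant

variable {E : Type*} [NormedAddCommGroup E] [InnerProductSpace ℝ E]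
variable {V : Type*} [AddCommGroup V] (φ : V →+ E) {n : ℕ}

omit φ in
/-- **The Gram–Schmidt norms never exceed their initial maximum** (LLL82: "|b*ᵢ|² ≤ B
throughout"; Bremner Thm. 4.23, proof): an exchange at a failed Lovász test keeps a bound
`‖b*ⱼ‖² ≤ B` (`δ ≤ 1`, linearly independent family).
[cite: LenstraLenstraLovasz1982, proof of Prop. 1.26] [cite: Bremner2011, Thm. 4.23 (proof)] -/
theorem sq_norm_gramSchmidt_swap_le {δ B : ℝ} (hδ1 : δ ≤ 1) {f : Fin n → E}
    (hf : LinearIndependent ℝ f) (hB : ∀ j, ‖gramSchmidt ℝ f j‖ ^ 2 ≤ B) (j₀ k : Fin n)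
    (hjk : (k : ℕ) = j₀ + 1) (hlov : ¬ LovaszTestAt δ f j₀ k) (j : Fin n) :
    ‖gramSchmidt ℝ (f ∘ Equiv.swap j₀ k) j‖ ^ 2 ≤ B := by
  have hjk' : j₀ < k := Fin.lt_def.2 (by omega)
  rcases lt_trichotomy j j₀ with h | h | h
  · rw [gramSchmidt_swap_of_gt f j₀ k j h (h.trans hjk')]
    exact hB j
  · subst h
    rw [gramSchmidt_swap_adjacent f j k hjk]
    unfold LovaszTestAt at hlov
    have h1 := le_of_lt (not_le.1 hlov)
    calc _ ≤ δ * ‖gramSchmidt ℝ f j‖ ^ 2 := h1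
      _ ≤ 1 * ‖gramSchmidt ℝ f j‖ ^ 2 := mul_le_mul_of_nonneg_right hδ1 (sq_nonneg _)
      _ ≤ B := by rw [one_mul]; exact hB j
  · have hkj : k ≤ j := Fin.le_def.2 (by have := Fin.lt_def.1 h; omega)
    rcases eq_or_lt_of_le hkj with h' | h'
    · subst h'
      exact (sq_norm_gramSchmidt_swap_right_le hf j₀ k hjk).trans (hB j₀)
    · rw [gramSchmidt_swap_of_lt f j₀ k j h h']
      exact hB j

omit φ in
/-- Coefficients of a short row are small: `‖bᵢ‖² ≤ nB`, all `‖b*ⱼ‖² ≤ B` (`B ≥ 1`), integral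
Gram determinants and `j + 1 ≤ n - 1` give `|μᵢⱼ| ≤ C` whenever `C² ≥ n B^{n-1}`
(`μᵢⱼ² ≤ dⱼ ‖bᵢ‖² ≤ Bʲ · nB`). [cite: LenstraLenstraLovasz1982, proof of Prop. 1.26] [cite: Bremner2011, Thm. 4.23 (4.8)] -/
theorem abs_gsCoeff_le_of_short {B C : ℝ} (hB1 : 1 ≤ B) (hC0 : 0 ≤ C)
    (hCB : (n : ℝ) * B ^ (n - 1) ≤ C ^ 2) (f : Fin n → E)
    (hfB : ∀ j, ‖gramSchmidt ℝ f j‖ ^ 2 ≤ B) (hf1 : ∀ (i : ℕ) (hi : i ≤ n), 1 ≤ gramDet f i hi)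
    (i j : Fin n) (hj : (j : ℕ) + 1 ≤ n - 1) (hfi : ‖f i‖ ^ 2 ≤ n * B) :
    |gsCoeff f i j| ≤ C := by
  refine abs_le_of_sq_le_sq ?_ hC0
  have h1 := gsCoeff_sq_le_gramDet_mul f i j (hf1 _ _)
  have h2 : gramDet f j (le_of_lt j.isLt) ≤ B ^ (j : ℕ) := gramDet_le_pow_of_gramSchmidt f hfB _ _
  have h3 : B ^ (j : ℕ) * (n * B) ≤ n * B ^ (n - 1) := by
    rw [mul_left_comm, ← pow_succ]
    exact mul_le_mul_of_nonneg_left (pow_le_pow_right₀ hB1 hj) (Nat.cast_nonneg _)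
  calc gsCoeff f i j ^ 2 ≤ gramDet f j (le_of_lt j.isLt) * ‖f i‖ ^ 2 := h1
    _ ≤ B ^ (j : ℕ) * (n * B) := mul_le_mul h2 hfi (sq_nonneg _) (pow_nonneg (by linarith) _)
    _ ≤ n * B ^ (n - 1) := h3
    _ ≤ C ^ 2 := hCB

/-- **One pass of the algorithm, seen by the size bounds** (LLL82, proof of Prop. 1.26, second
half; Bremner Thm. 4.23): with `B ≥ 1` a bound on the initial squared norms and
`C² ≥ n B^{n-1}`, `C ≥ 1`, the three clauses — all `‖b*ⱼ‖² ≤ B`; `‖bᵢ‖² ≤ n B` for the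
positions `i > k`; `|μₖⱼ| ≤ 2^{n-1-k} C` for `j < k` — are preserved by `lllStep` from a
running state (`0 < k < n`) of a linearly independent family with integral Gram determinants
(`dᵢ ≥ 1`, hypothesis `hint`, true for integer vectors) satisfying the loop invariant
`|μᵢⱼ| ≤ 1/2` (`j < i < k`). The third clause at most doubles at an exchange
(`|μₖⱼ - r μₖ₋₁,ⱼ| ≤ |μₖⱼ| + (|μₖ,ₖ₋₁| + ½) · ½`) while `k` drops by one, and is
re-initialised from `μᵢⱼ² ≤ dⱼ ‖bᵢ‖² ≤ Bʲ · nB` after an increment.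
[cite: LenstraLenstraLovasz1982, Prop. 1.26 (proof)] [cite: Bremner2011, Thm. 4.23] -/
theorem lllStep_size_invariant {δ B C : ℝ} (hδ1 : δ ≤ 1) (hB1 : 1 ≤ B) (hC : 1 ≤ C)
    (hCB : (n : ℝ) * B ^ (n - 1) ≤ C ^ 2)
    (hint : ∀ b' : Fin n → V, LinearIndependent ℝ (⇑φ ∘ b') →
      ∀ (i : ℕ) (hi : i ≤ n), 1 ≤ gramDet (⇑φ ∘ b') i hi)
    (s : LLLState n V) (hk : 0 < s.k ∧ s.k < n)
    (hind : LinearIndependent ℝ (⇑φ ∘ s.b))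
    (hred : ∀ i j : Fin n, j < i → (i : ℕ) < s.k → |gsCoeff (⇑φ ∘ s.b) i j| ≤ 1 / 2)
    (ha : ∀ j, ‖gramSchmidt ℝ (⇑φ ∘ s.b) j‖ ^ 2 ≤ B)
    (hb : ∀ i : Fin n, s.k < i.val → ‖(⇑φ ∘ s.b) i‖ ^ 2 ≤ n * B)
    (hc : ∀ (hk' : s.k < n) (j : Fin n), j.val < s.k →
      |gsCoeff (⇑φ ∘ s.b) ⟨s.k, hk'⟩ j| ≤ 2 ^ (n - 1 - s.k) * C) :
    (∀ j, ‖gramSchmidt ℝ (⇑φ ∘ (lllStep φ δ s).b) j‖ ^ 2 ≤ B) ∧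
    (∀ i : Fin n, (lllStep φ δ s).k < i.val → ‖(⇑φ ∘ (lllStep φ δ s).b) i‖ ^ 2 ≤ n * B) ∧
    (∀ (hk' : (lllStep φ δ s).k < n) (j : Fin n), j.val < (lllStep φ δ s).k →
      |gsCoeff (⇑φ ∘ (lllStep φ δ s).b) ⟨(lllStep φ δ s).k, hk'⟩ j| ≤
        2 ^ (n - 1 - (lllStep φ δ s).k) * C) := by
  have hB0 : 0 ≤ B := zero_le_one.trans hB1
  have hC0 : 0 ≤ C := zero_le_one.trans hC
  unfold lllStep
  rw [dif_pos hk]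
  dsimp only
  set k : Fin n := ⟨s.k, hk.2⟩ with hkdef
  set j₀ : Fin n := ⟨s.k - 1, by omega⟩ with hj₀def
  have hkv : (k : ℕ) = s.k := rfl
  have hj₀v : (j₀ : ℕ) = s.k - 1 := rfl
  have hjk : j₀ < k := Fin.mk_lt_mk.2 (by omega)
  have hjk' : (k : ℕ) = j₀ + 1 := by simp [hkdef, hj₀def]; omega
  set b₁ := lllSizeReduce φ s.b k j₀ with hb₁def
  -- facts about `b₁ = reduce(k, k-1)`
  have hGS₁ : gramSchmidt ℝ (⇑φ ∘ b₁) = gramSchmidt ℝ (⇑φ ∘ s.b) :=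
    gramSchmidt_lllSizeReduce φ s.b hjk
  have hrow₁ : ∀ i : Fin n, i ≠ k → ∀ j, gsCoeff (⇑φ ∘ b₁) i j = gsCoeff (⇑φ ∘ s.b) i j :=
    fun i hi j => gsCoeff_lllSizeReduce_of_ne φ s.b hjk hi j
  have hvec₁ : ∀ i : Fin n, i ≠ k → b₁ i = s.b i :=
    fun i hi => lllSizeReduce_apply_of_ne φ s.b k j₀ hi
  have hind₁ : LinearIndependent ℝ (⇑φ ∘ b₁) := linearIndependent_of_gramSchmidt_eq hGS₁.symm hind
  have ha₁ : ∀ j, ‖gramSchmidt ℝ (⇑φ ∘ b₁) j‖ ^ 2 ≤ B := fun j => by rw [hGS₁]; exact ha j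
  have hμ₁ : |gsCoeff (⇑φ ∘ b₁) k j₀| ≤ 1 / 2 := abs_gsCoeff_lllSizeReduce_le φ s.b hjk
  -- the doubling estimate for row `k` of `b₁`
  set R : ℝ := 2 ^ (n - 1 - s.k) * C with hR
  have hR1 : 1 ≤ R := by
    rw [hR]; nlinarith [one_le_pow₀ (M₀ := ℝ) (a := 2) (n := n - 1 - s.k) (by norm_num)]
  have hdouble : ∀ j : Fin n, j < k → |gsCoeff (⇑φ ∘ b₁) k j| ≤ 2 * R := by
    intro j hj
    rcases eq_or_lt_of_le (Fin.le_def.2 (by have := Fin.lt_def.1 hj; omega) :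
      j ≤ j₀) with hj' | hj'
    · rw [hj']; linarith
    · obtain ⟨c, hc_le, hc_eq⟩ := exists_comp_lllSizeReduce_eq_abs_le φ s.b k j₀
      have e : gsCoeff (⇑φ ∘ b₁) k j = gsCoeff (⇑φ ∘ s.b) k j - c * gsCoeff (⇑φ ∘ s.b) j₀ j := by
        rw [hb₁def, hc_eq, gsCoeff_update_sub_smul_self _ hjk]
      rw [e]
      have h1 : |gsCoeff (⇑φ ∘ s.b) k j| ≤ R := hc hk.2 j (Fin.lt_def.1 hj)
      have h2 : |gsCoeff (⇑φ ∘ s.b) k j₀| ≤ R := hc hk.2 j₀ (Fin.lt_def.1 hjk)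
      have h3 : |gsCoeff (⇑φ ∘ s.b) j₀ j| ≤ 1 / 2 := hred j₀ j hj' (by omega)
      have h4 : |c| ≤ R + 1 / 2 := hc_le.trans (by linarith)
      calc |gsCoeff (⇑φ ∘ s.b) k j - c * gsCoeff (⇑φ ∘ s.b) j₀ j|
          ≤ |gsCoeff (⇑φ ∘ s.b) k j| + |c| * |gsCoeff (⇑φ ∘ s.b) j₀ j| := by
            rw [← abs_mul]; exact abs_sub _ _
        _ ≤ R + (R + 1 / 2) * (1 / 2) :=
            add_le_add h1 (mul_le_mul h4 h3 (abs_nonneg _) (by linarith))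
        _ ≤ 2 * R := by linarith
  split_ifs with ht
  · ---------------- increment ----------------
    dsimp only
    obtain ⟨h1, h2, -, -⟩ := lllSizeReduceFrom_spec φ k (k.val - 1) (by omega) (by omega) b₁
    change gramSchmidt ℝ (⇑φ ∘ lllSizeReduceBelow φ b₁ k) = _ at h1
    change ∀ i : Fin n, i ≠ k → ∀ j, gsCoeff (⇑φ ∘ lllSizeReduceBelow φ b₁ k) i j = _ at h2
    have hvec₂ : ∀ i : Fin n, i ≠ k → lllSizeReduceBelow φ b₁ k i = s.b i := fun i hi => by
      rw [lllSizeReduceBelow, lllSizeReduceFrom_apply_of_ne φ k hi, hvec₁ i hi]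
    refine ⟨fun j => by rw [h1]; exact ha₁ j, fun i hi => ?_, fun hk' j hj => ?_⟩
    · have hik : i ≠ k := fun h => by have := congrArg Fin.val h; omega
      rw [comp_apply, hvec₂ i hik]
      exact hb i (by omega)
    · -- the new row `k + 1` is a short row of the old family
      have hik : (⟨s.k + 1, hk'⟩ : Fin n) ≠ k := fun h => by
        have := congrArg Fin.val h; simp only at this; omega
      rw [h2 _ hik, hrow₁ _ hik]
      have hCle : C ≤ 2 ^ (n - 1 - (s.k + 1)) * C :=
        le_mul_of_one_le_left hC0 (one_le_pow₀ (by norm_num))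
      refine le_trans ?_ hCle
      refine abs_gsCoeff_le_of_short hB1 hC0 hCB (⇑φ ∘ s.b) ha (hint _ hind) _ j (by omega) ?_
      exact hb ⟨s.k + 1, hk'⟩ (by simp)
  · ---------------- exchange ----------------
    dsimp only
    have hcomp : (⇑φ ∘ b₁ ∘ ⇑(Equiv.swap j₀ k)) = (⇑φ ∘ b₁) ∘ ⇑(Equiv.swap j₀ k) := rfl
    refine ⟨fun j => ?_, fun i hi => ?_, fun hk' j hj => ?_⟩
    · rw [hcomp]
      exact sq_norm_gramSchmidt_swap_le hδ1 hind₁ ha₁ j₀ k hjk' ht j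
    · -- positions above the new index
      show ‖φ (b₁ (Equiv.swap j₀ k i))‖ ^ 2 ≤ n * B
      have hi0 : s.k - 1 < i.val := lt_of_le_of_lt (le_max_right _ _) hi
      rcases Nat.lt_or_ge i.val (s.k + 1) with hi' | hi'
      · -- `i = k` (new index is `k - 1` or `1`): the new vector is the old `b_{k-1}` (or `b₀`)
        have hi1 : 1 < i.val := lt_of_le_of_lt (le_max_left _ _) hi
        have hi2 : i = k := Fin.ext (by omega)
        rw [hi2, Equiv.swap_apply_right, hvec₁ j₀ (ne_of_lt hjk)]
        exact sq_norm_le_of_sizeReduced_row (⇑φ ∘ s.b) ha j₀ fun j hj =>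
          hred j₀ j hj (by omega)
      · have hij : i ≠ j₀ := fun h => by have := congrArg Fin.val h; omega
        have hik : i ≠ k := fun h => by have := congrArg Fin.val h; omega
        rw [Equiv.swap_apply_of_ne_of_ne hij hik, hvec₁ i hik]
        exact hb i (by omega)
    · -- the new row at the new index
      by_cases h1 : s.k = 1
      · -- `k = 1`: the new index is `1`, the new row `1` is the old `b₀`, the new `d₀ = 1`
        have hmax : max 1 (s.k - 1) = 1 := by rw [h1]; rfl
        have hn1 : n - 1 - max 1 (s.k - 1) = n - 1 - (0 + 1) := by rw [hmax]
        rw [hn1]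
        have hCle : C ≤ 2 ^ (n - 1 - (0 + 1)) * C :=
          le_mul_of_one_le_left hC0 (one_le_pow₀ (by norm_num))
        refine le_trans ?_ hCle
        have hg_ind : LinearIndependent ℝ ((⇑φ ∘ b₁) ∘ ⇑(Equiv.swap j₀ k)) :=
          hind₁.comp _ (Equiv.injective _)
        have hgB : ∀ j, ‖gramSchmidt ℝ ((⇑φ ∘ b₁) ∘ ⇑(Equiv.swap j₀ k)) j‖ ^ 2 ≤ B :=
          fun j => sq_norm_gramSchmidt_swap_le hδ1 hind₁ ha₁ j₀ k hjk' ht j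
        have hnew : (⟨max 1 (s.k - 1), hk'⟩ : Fin n) = k := Fin.ext (by simp only; omega)
        rw [hcomp, hnew]
        refine abs_gsCoeff_le_of_short hB1 hC0 hCB _ hgB (hint _ (by exact hg_ind)) k j
          (by rw [hmax] at hj; omega) ?_
        rw [comp_apply, Equiv.swap_apply_right, comp_apply, hvec₁ j₀ (ne_of_lt hjk)]
        -- `‖b_{k-1}‖² ≤ nB` (size-reduced row)
        exact sq_norm_le_of_sizeReduced_row (⇑φ ∘ s.b) ha j₀ fun j hj =>
          hred j₀ j hj (by simp [hj₀def]; omega)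
      · -- `k ≥ 2`: the new index is `k - 1 = j₀`, the new row there is row `k` of `b₁`
        have hmax : max 1 (s.k - 1) = s.k - 1 := by
          rw [max_eq_right]; omega
        have hnew : (⟨max 1 (s.k - 1), hk'⟩ : Fin n) = j₀ := Fin.ext (by simp only; omega)
        have hexp : n - 1 - max 1 (s.k - 1) = (n - 1 - s.k) + 1 := by rw [hmax]; omega
        rw [hnew, hexp, pow_succ, show (2 : ℝ) ^ (n - 1 - s.k) * 2 * C = 2 * R by rw [hR]; ring]
        have hjlt : j < j₀ := Fin.lt_def.2 (by rw [hmax] at hj; omega)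
        -- `μ'_{k-1, j} = μ₁_{k j}`
        have e : gsCoeff (⇑φ ∘ b₁ ∘ ⇑(Equiv.swap j₀ k)) j₀ j = gsCoeff (⇑φ ∘ b₁) k j := by
          rw [hcomp, gsCoeff, gsCoeff, gramSchmidt_swap_of_gt _ j₀ k j hjlt (hjlt.trans hjk),
            comp_apply, Equiv.swap_apply_left]
        rw [e]
        exact hdouble j (hjlt.trans hjk)

end SizeInvariant

section SizeRun

variable {m : ℕ}

/-- **Discharge of `lll_norm_sq_le`** (LLL82, proof of Prop. 1.26, second half; Bremner
Thm. 4.23 (4.6)): along the run of the algorithm on linearly independent integer vectors with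
`‖bᵢ‖² ≤ B`, every vector satisfies `‖bᵢ‖² ≤ n² (4B)ⁿ`. The three clauses of
`lllStep_size_invariant` (with `C = √(n B^{n-1})`) hold initially and along the run; at any
time, rows `i < k` are size-reduced (`‖bᵢ‖² ≤ nB`), rows `i > k` satisfy `‖bᵢ‖² ≤ nB`, and
row `k` satisfies `‖bₖ‖² ≤ n (2^{n-1-k} C)² B ≤ n² 4^{n-1-k} Bⁿ`.
[cite: LenstraLenstraLovasz1982, Prop. 1.26 (proof)] [cite: Bremner2011, Thm. 4.23 (4.6)] -/
theorem lll_norm_sq_le_holds : lll_norm_sq_le := by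
  intro n m δ B b hδ hδ1 hli hB t
  set φ := (intVecToEuclidean m).toAddMonoidHom with hφ
  rcases Nat.eq_zero_or_pos n with hn | hn
  · subst hn; intro i; exact i.elim0
  -- constants
  have hint : ∀ b' : Fin n → (Fin m → ℤ), LinearIndependent ℝ (⇑φ ∘ b') →
      ∀ (i : ℕ) (hi : i ≤ n), 1 ≤ gramDet (⇑φ ∘ b') i hi := fun b' hb' i hi =>
    one_le_gramDet b' hb' i hi
  have hGS0 : ∀ j, ‖gramSchmidt ℝ (⇑φ ∘ b) j‖ ^ 2 ≤ B := by
    intro j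
    refine le_trans ?_ (hB j)
    change _ ≤ ‖(⇑φ ∘ b) j‖ ^ 2
    rw [sq_norm_eq_sq_norm_gramSchmidt_add_sum (⇑φ ∘ b) j]
    exact le_add_of_nonneg_right (Finset.sum_nonneg fun l _ => mul_nonneg (sq_nonneg _) (sq_nonneg _))
  have hB1 : 1 ≤ B := by
    have h1 : 1 ≤ gramDet (⇑φ ∘ b) (((⟨0, hn⟩ : Fin n) : ℕ) + 1) (⟨0, hn⟩ : Fin n).isLt :=
      hint b hli _ _
    rw [gramDet_succ, gramDet_zero, one_mul] at h1
    exact h1.trans (hGS0 _)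
  have hB0 : 0 ≤ B := zero_le_one.trans hB1
  set C : ℝ := Real.sqrt (n * B ^ (n - 1)) with hC
  have hCB : (n : ℝ) * B ^ (n - 1) ≤ C ^ 2 := by
    rw [hC, Real.sq_sqrt (by positivity)]
  have hC1 : 1 ≤ C := by
    rw [hC, Real.le_sqrt' zero_lt_one, one_pow]
    have h1 : (1 : ℝ) ≤ n := by exact_mod_cast hn
    nlinarith [one_le_pow₀ (n := n - 1) hB1]
  have hC0 : 0 ≤ C := zero_le_one.trans hC1
  -- the run
  set s : ℕ → LLLState n (Fin m → ℤ) := fun t => (lllStep φ δ)^[t] (lllStart b) with hs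
  have hsucc : ∀ t, s (t + 1) = lllStep φ δ (s t) := fun t => by
    simp only [hs]; rw [iterate_succ_apply']
  have hli' : ∀ t, LinearIndependent ℝ (⇑φ ∘ (s t).b) := linearIndependent_iterate φ δ b hli
  have hred : ∀ t, ∀ i j : Fin n, j < i → (i : ℕ) < (s t).k → |gsCoeff (⇑φ ∘ (s t).b) i j| ≤ 1 / 2 :=
    fun t => (iterate_lllStep_invariant φ δ b t).1
  have hk1 : ∀ t, 1 ≤ (s t).k := by
    intro t
    cases t with
    | zero => exact le_rfl
    | succ t => rw [hsucc]; exact one_le_lllStep_k φ _ hn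
  have hinv : ∀ t,
      (∀ j, ‖gramSchmidt ℝ (⇑φ ∘ (s t).b) j‖ ^ 2 ≤ B) ∧
      (∀ i : Fin n, (s t).k < i.val → ‖(⇑φ ∘ (s t).b) i‖ ^ 2 ≤ n * B) ∧
      (∀ (hk' : (s t).k < n) (j : Fin n), j.val < (s t).k →
        |gsCoeff (⇑φ ∘ (s t).b) ⟨(s t).k, hk'⟩ j| ≤ 2 ^ (n - 1 - (s t).k) * C) := by
    intro t
    induction t with
    | zero =>
      have hk0 : (s 0).k = 1 := rfl
      have hb0 : (s 0).b = b := rfl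
      refine ⟨fun j => by rw [hb0]; exact hGS0 j, fun i hi => ?_, fun hk' j hj => ?_⟩
      · rw [hb0]
        refine (hB i).trans ?_
        have : (1 : ℝ) ≤ n := by exact_mod_cast hn
        nlinarith
      · have hj1 : (j : ℕ) < 1 := hj
        have hk'' : 1 < n := hk'
        have hj0 : j = ⟨0, hn⟩ := Fin.ext (by simp only; omega)
        subst hj0
        show |gsCoeff (⇑φ ∘ b) ⟨1, hk''⟩ ⟨0, hn⟩| ≤ 2 ^ (n - 1 - 1) * C
        refine le_trans ?_ (le_mul_of_one_le_left hC0 (one_le_pow₀ (by norm_num)))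
        refine abs_gsCoeff_le_of_short hB1 hC0 hCB (⇑φ ∘ b) hGS0 (hint b hli) ⟨1, hk''⟩ ⟨0, hn⟩
          (by simp only; omega) ?_
        refine (hB _).trans ?_
        have : (1 : ℝ) ≤ n := by exact_mod_cast hn
        nlinarith
    | succ t ih =>
      obtain ⟨iha, ihb, ihc⟩ := ih
      by_cases hlt : (s t).k < n
      · rw [hsucc]
        exact lllStep_size_invariant φ hδ1.le hB1 hC1 hCB hint (s t) ⟨hk1 t, hlt⟩ (hli' t)
          (hred t) iha ihb ihc
      · rw [hsucc, lllStep_of_le φ (not_lt.1 hlt)]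
        exact ⟨iha, ihb, ihc⟩
  -- conclusion at time `t`
  obtain ⟨hta, htb, htc⟩ := hinv t
  show ∀ i : Fin n, ‖intVecToEuclidean m ((s t).b i)‖ ^ 2 ≤ (n : ℝ) ^ 2 * (4 * B) ^ n
  intro i
  have hnB : (n : ℝ) * B ≤ (n : ℝ) ^ 2 * (4 * B) ^ n := by
    have h1 : (1 : ℝ) ≤ n := by exact_mod_cast hn
    have h2 : B ≤ (4 * B) ^ n := by
      calc B ≤ 4 * B := by linarith
        _ ≤ (4 * B) ^ n := le_self_pow₀ (by linarith) hn.ne'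
    calc (n : ℝ) * B ≤ n * (4 * B) ^ n := mul_le_mul_of_nonneg_left h2 (by positivity)
      _ ≤ (n : ℝ) ^ 2 * (4 * B) ^ n := by
          rw [sq]; exact mul_le_mul_of_nonneg_right (le_mul_of_one_le_left (by positivity) h1)
            (by positivity)
  rcases lt_trichotomy i.val (s t).k with h | h | h
  · -- size-reduced rows
    refine le_trans ?_ hnB
    exact sq_norm_le_of_sizeReduced_row _ hta i fun j hj => hred t i j hj h
  · -- the current row
    have hk' : (s t).k < n := h ▸ i.isLt
    have hik : i = ⟨(s t).k, hk'⟩ := Fin.ext h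
    set R : ℝ := 2 ^ (n - 1 - (s t).k) * C with hR
    have hR1 : 1 ≤ R := by
      rw [hR]; nlinarith [one_le_pow₀ (M₀ := ℝ) (a := 2) (n := n - 1 - (s t).k) (by norm_num)]
    have h1 := sq_norm_le_of_abs_gsCoeff_le _ hta hR1 i fun j hj => by
      rw [hik] at hj ⊢; exact htc hk' j (Fin.lt_def.1 hj)
    refine h1.trans ?_
    -- `n R² B = n 4^{n-1-k} (n B^{n-1}) B ≤ n² 4ⁿ Bⁿ`
    have hR2 : R ^ 2 = 4 ^ (n - 1 - (s t).k) * C ^ 2 := by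
      rw [hR, mul_pow, pow_right_comm]; norm_num
    have hC2 : C ^ 2 = n * B ^ (n - 1) := by rw [hC, Real.sq_sqrt (by positivity)]
    rw [hR2, hC2]
    have h4 : (4 : ℝ) ^ (n - 1 - (s t).k) ≤ 4 ^ n := pow_le_pow_right₀ (by norm_num) (by omega)
    have hBn : B ^ (n - 1) * B = B ^ n := by
      rw [← pow_succ, Nat.sub_add_cancel hn]
    calc (n : ℝ) * (4 ^ (n - 1 - (s t).k) * (n * B ^ (n - 1))) * B
        = (n : ℝ) ^ 2 * 4 ^ (n - 1 - (s t).k) * (B ^ (n - 1) * B) := by ring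
      _ ≤ (n : ℝ) ^ 2 * 4 ^ n * (B ^ (n - 1) * B) := by
          refine mul_le_mul_of_nonneg_right (mul_le_mul_of_nonneg_left h4 (by positivity)) ?_
          rw [hBn]; positivity
      _ = (n : ℝ) ^ 2 * (4 * B) ^ n := by rw [hBn, mul_pow]; ring
  · -- rows above the current index
    exact (htb i h).trans hnB

end SizeRun

end Literature.Algebra.EuclideanLattices
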